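import Summits.Parity.GeneralizedHardyLittlewood.Theorems.BeyondDiagonalBeatsQuarter.CornerWeight
import Mathlib.MeasureTheory.Integral.IntegralEqImproper
import HarnessLib

/-!
# Route `PrimeLevelFamEdge`, crux K_A `MomentsBeyondDiagonal` (stmt-Parity-20007), line «petersson_layers» v4, stub `stub_diag`:
# CONSISTENCY AT ORDER `(0, 0)` — the Bose double integral of `…DiagLineSum` IS K_B's corner weight `Corner.scriptW`

`…DiagLineSum.hasSum_inv_mul_logCutoffW` (p811070) sums the order-`(i,j)` AFE weight along a diagonal line into
`𝔚_{ij}(A₁,A₂;y) = ∫_{u₁>0}(A₁+log u₁)^i ∫_{u₂>y/u₁} e^{−φ}(1−e^{−φ})^{−2}(A₂+log u₂)^j` (`φ = u₁+u₂`). At `i = j = 0` the inner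
integral is elementary — `∫_{u₂>z} e^{−(u₁+u₂)}(1−e^{−(u₁+u₂)})^{−2} du₂ = 1/(e^{u₁+z} − 1)` (`integral_Ioi_bose_eq`) — so
`𝔚₀₀(A₁,A₂;y) = ∫_0^∞ du₁/(e^{u₁+y/u₁} − 1) = Corner.scriptW y` (`bose_zero_zero_eq_scriptW`), the TRUE Petersson-diagonal weight of
crux K_B's `Corner.trueDiagKernel` (stmt-Parity-20343, `CornerWeight` / `CornerWeightAFEBridge`): the two kernel-checked routes to the
`Q = 1` diagonal (K_B's `Σ_l W(l²y)/l` and this line's order-`(i,j)` summation) agree, and `c₀₀(y) = 𝒲(y)` is the anchor of the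
Bose coefficients `c_{ab}(y)` (census R2). Helper `--supports stmt-Parity-20007`; closes nothing; K_A, K_B and the Parity summit are
NOT proved; nothing about Landau–Siegel zeros.
-/

noncomputable section

open Real Set MeasureTheory Filter Topology

namespace Summit.Parity.GeneralizedHardyLittlewood.Theorems.MomentsBeyondDiagonal.DiagLines

open Summit.Parity.GeneralizedHardyLittlewood.Theorems.BeyondDiagonalBeatsQuarter

/-- The Bose-type kernel in the two forms: `e^{−φ}/(1 − e^{−φ})² = e^{φ}/(e^{φ} − 1)²` (`φ ≠ 0` not needed: both sides are the
same rational function of `e^{φ}`). [folklore] -/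
theorem bose_kernel_eq (φ : ℝ) :
    Real.exp (-φ) / (1 - Real.exp (-φ)) ^ 2 = Real.exp φ / (Real.exp φ - 1) ^ 2 := by
  have hE : Real.exp φ ≠ 0 := (Real.exp_pos φ).ne'
  rw [Real.exp_neg]
  by_cases h : Real.exp φ = 1
  · simp [h]
  · have h1 : Real.exp φ - 1 ≠ 0 := sub_ne_zero.mpr h
    have h2 : 1 - (Real.exp φ)⁻¹ ≠ 0 := by
      rw [sub_ne_zero, ne_comm, ne_eq, inv_eq_one]; exact h
    field_simp

/-- **The inner integral at order `(0,0)` is elementary**: for `z > 0` and every `u₁`,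
`∫_{u₂ > z} e^{−(u₁+u₂)}(1 − e^{−(u₁+u₂)})^{−2} du₂ = 1/(e^{u₁+z} − 1)` (antiderivative `−1/(e^{u₁+u₂} − 1)`). [folklore] -/
theorem integral_Ioi_bose_eq (u₁ : ℝ) {z : ℝ} (hz : 0 < u₁ + z) :
    ∫ u₂ in Ioi z, Real.exp (-(u₁ + u₂)) / (1 - Real.exp (-(u₁ + u₂))) ^ 2 = (Real.exp (u₁ + z) - 1)⁻¹ := by
  -- `g(u₂) = -(e^{u₁+u₂} - 1)⁻¹`, `g' = e^{φ}/(e^{φ}-1)²`, `g → 0`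
  have hpos : ∀ u₂ ∈ Ici z, 0 < Real.exp (u₁ + u₂) - 1 := by
    intro u₂ hu₂
    have : 0 < u₁ + u₂ := lt_of_lt_of_le hz (by have : z ≤ u₂ := hu₂; linarith)
    have : 1 < Real.exp (u₁ + u₂) := Real.one_lt_exp_iff.mpr this
    linarith
  have hderiv : ∀ u₂ ∈ Ioi z, HasDerivAt (fun u : ℝ ↦ -(Real.exp (u₁ + u) - 1)⁻¹)
      (Real.exp (-(u₁ + u₂)) / (1 - Real.exp (-(u₁ + u₂))) ^ 2) u₂ := by
    intro u₂ hu₂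
    have hne : Real.exp (u₁ + u₂) - 1 ≠ 0 := (hpos u₂ (Set.mem_Ici.mpr (le_of_lt hu₂))).ne'
    have h1 : HasDerivAt (fun u : ℝ ↦ Real.exp (u₁ + u) - 1) (Real.exp (u₁ + u₂)) u₂ := by
      have h := ((hasDerivAt_id u₂).const_add u₁).exp
      simpa using h.sub_const 1
    have h2 := (h1.inv hne).neg
    rw [bose_kernel_eq]
    exact h2.congr_deriv (by ring)
  have hcont : ContinuousWithinAt (fun u : ℝ ↦ -(Real.exp (u₁ + u) - 1)⁻¹) (Ici z) z := by
    have hne : Real.exp (u₁ + z) - 1 ≠ 0 := (hpos z (Set.mem_Ici.mpr le_rfl)).ne'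
    refine ContinuousAt.continuousWithinAt ?_
    exact ((((continuous_const.add continuous_id).rexp.sub continuous_const).continuousAt).inv₀ hne).neg
  have hnonneg : ∀ u₂ ∈ Ioi z, 0 ≤ Real.exp (-(u₁ + u₂)) / (1 - Real.exp (-(u₁ + u₂))) ^ 2 :=
    fun u₂ _ ↦ div_nonneg (Real.exp_pos _).le (sq_nonneg _)
  have hlim : Tendsto (fun u : ℝ ↦ -(Real.exp (u₁ + u) - 1)⁻¹) atTop (𝓝 0) := by
    rw [show (0 : ℝ) = -0 by simp]
    refine Tendsto.neg ?_
    refine tendsto_inv_atTop_zero.comp ?_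
    have h : Tendsto (fun u : ℝ ↦ Real.exp (u₁ + u)) atTop atTop :=
      Real.tendsto_exp_atTop.comp (tendsto_atTop_add_const_left _ _ tendsto_id)
    exact tendsto_atTop_add_const_right _ _ h
  rw [integral_Ioi_of_hasDerivAt_of_nonneg hcont hderiv hnonneg hlim]
  ring

/-- **Consistency at order `(0,0)`**: for `y > 0` and all `A₁, A₂`,
`∫_{u₁>0}(A₁+log u₁)^0 ∫_{u₂>y/u₁} e^{−(u₁+u₂)}(1−e^{−(u₁+u₂)})^{−2}(A₂+log u₂)^0 du₂ du₁ = Corner.scriptW y = ∫_0^∞ dv/(e^{v+y/v} − 1)` —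
the order-`(0,0)` Bose double integral of `…DiagLineSum` is the true Petersson-diagonal weight `𝒲` of K_B's `Corner.trueDiagKernel`.
[cite: KowalskiMichelVanderKam2000, (21)–(23) p. 12–13 and Prop. 5.1 — derivation] -/
theorem bose_zero_zero_eq_scriptW {y : ℝ} (hy : 0 < y) (A₁ A₂ : ℝ) :
    ∫ u₁ in Ioi (0 : ℝ), (A₁ + Real.log u₁) ^ 0 *
        ∫ u₂ in Ioi (y / u₁), Real.exp (-(u₁ + u₂)) / (1 - Real.exp (-(u₁ + u₂))) ^ 2 * (A₂ + Real.log u₂) ^ 0 =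
      Corner.scriptW y := by
  unfold Corner.scriptW
  refine setIntegral_congr_fun measurableSet_Ioi fun u₁ hu₁ ↦ ?_
  have hu₁ : 0 < u₁ := hu₁
  simp only [pow_zero, one_mul, mul_one]
  exact integral_Ioi_bose_eq u₁ (by positivity)

end Summit.Parity.GeneralizedHardyLittlewood.Theorems.MomentsBeyondDiagonal.DiagLines

end
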